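import Summits.BirchSwinnertonDyer.BirchSwinnertonDyer.Theorems.SignedLowerHalvesSmallImageLowerHalfBothSignsRttCharRoadE1CoresDescent
import Summits.BirchSwinnertonDyer.BirchSwinnertonDyer.Theorems.SignedLowerHalvesSmallImageLowerHalfBothSignsRttCharRoadE1KStructure
import HarnessLib

/-!
# Route `SignedLowerHalves`, crux L `SmallImageLowerHalfBothSigns` (stmt-BirchSwinnertonDyer-23599), line `rtt_w3` v12 — glue BLOCK I (cores-pair injectivity
# ON `W[p]`-CLASSES, instantiated): for the small-image datum `(Φ, k, e₀)` of the registered stub, any subgroup `H ≤ Γ_F` (a layer `Γ_{ℚ_n}` or `Γ_{ℚ_∞}`),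
# `N = (ρ̄⁻¹ kˣ) ∩ H` (= `H ∩ Γ_K`, the classes over `K_n` / `K_∞`) open of index `2` in `H` with transversal `c` (`ρ̄(c) ∉ kˣ`), the map
# `ξ ↦ (cor ξ, cor (u_* ξ))`, `H¹(N, W[p]) → H¹(H, W[p])²`, is INJECTIVE — `u` the `k`-structure endomorphism of brick I-k
# (`exists_kStructure_endomorphism`), `cor` the tree's index-two transfer `corH1`; the generic injectivity is -w3 g17's
# `injective_corH1_prod_corH1_pushH1` (p765568).

LEAD `cruxlead-stmt-BirchSwinnertonDyer-23599` g7 (cell `bsd-ssimc`; `--supports stmt-BirchSwinnertonDyer-23599 --as helper`). THEOREMS ONLY (no definition,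
no named fact, no instance, no `sorry`). This is block I of the glue cut T / DESC / I of INJ_top (card `Lines/rtt_w3_v12.md`): it is what makes the
`N = 2·#J` classes `cor ξ_j, cor (u_* ξ_j)` of the cores route jointly faithful. BSD / crux L / INJ_top are NOT proved here.

WHAT: `mem_unitGroup_of_mem_subgroupOf` (bookkeeping), ★ `exists_injective_corH1_pair_geomTorsion`.

References: [SerreGaloisCohomology1997] I §2.4, I §2.6 (b); [Serre1972] §2.2; [NeukirchSchmidtWingberg2008] (1.5.7).
-/

set_option autoImplicit false
set_option linter.dupNamespace false -- D-0017: single-problem summit, the namespace repeats the problem name by design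
noncomputable section

open scoped Classical MatrixGroups
open Matrix

namespace Summit.BirchSwinnertonDyer.BirchSwinnertonDyer.Theorems.SmallImageCharSignedSelmer

open Literature.NumberTheory.GaloisRepresentations Literature.NumberTheory.GaloisRepresentations.Serre1972
  Literature.NumberTheory.EllipticCurves WeierstrassCurve

variable {F : Type} [Field F] (W : WeierstrassCurve F) {p : ℕ} [Fact p.Prime]

/-- Bookkeeping: an element of `N = (ρ̄⁻¹ kˣ) ∩ H` has `ρ̄`-image in `kˣ`. [folklore] -/
theorem mem_unitGroup_of_mem_subgroupOf (Φ : Multiplicative (AddAut (geomTorsion W p)) ≃* GL (Fin 2) (ZMod p))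
    (k : Subalgebra (ZMod p) (Matrix (Fin 2) (Fin 2) (ZMod p))) {H : Subgroup (Field.absoluteGaloisGroup F)}
    (x : (((unitGroup k).comap Φ.toMonoidHom).comap (galoisRepTorsion W p)).subgroupOf H) :
    Φ (galoisRepTorsion W p ((x : H) : Field.absoluteGaloisGroup F)) ∈ unitGroup k := by
  have hx := x.2
  rw [Subgroup.mem_subgroupOf, Subgroup.mem_comap, Subgroup.mem_comap] at hx
  exact hx

/-- ★ **Cores-pair injectivity on `W[p]`-classes (block I).** `(Φ, k, e₀)` the small-image datum (`k` a field of degree `2`, `ρ̄(Γ_F)` normalises `kˣ`, `p` odd);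
`H ≤ Γ_F` any subgroup; `N = (ρ̄⁻¹ kˣ).subgroupOf H` open and normal in `H`, with `G = N ⊔ N c` (`hc`, the tree's `Xor`); `W[p] = geomTorsion W p` with continuous
`H`-orbits. Then for the `k`-structure endomorphism `u` (brick I-k) the map `ξ ↦ (cor ξ, cor (u_* ξ))` on `H¹(N, W[p])` is injective (-w3 g17's
`injective_corH1_prod_corH1_pushH1`, `hpM`: `p` kills `W[p]`; `hcu` from `ρ̄(c) ∉ kˣ`, which follows from `hc`). [cite: SerreGaloisCohomology1997, I §2.6 (b)] [cite: Serre1972, §2.2] -/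
theorem exists_injective_corH1_pair_geomTorsion (hp : p ≠ 2)
    (Φ : Multiplicative (AddAut (geomTorsion W p)) ≃* GL (Fin 2) (ZMod p))
    (k : Subalgebra (ZMod p) (Matrix (Fin 2) (Fin 2) (ZMod p))) (e₀ : geomTorsion W p ≃+ (Fin 2 → ZMod p))
    (he₀ : ∀ (g : Multiplicative (AddAut (geomTorsion W p))) (x : geomTorsion W p),
      e₀ (Multiplicative.toAdd g x) = ((Φ g : GL (Fin 2) (ZMod p)) : Matrix (Fin 2) (Fin 2) (ZMod p)) *ᵥ e₀ x)
    (hk : IsField k) (h2 : Module.finrank (ZMod p) k = 2)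
    (hGN : (galoisRepTorsion W p).range.map Φ.toMonoidHom ≤
      Subgroup.normalizer (Serre1972.unitGroup k : Set (GL (Fin 2) (ZMod p))))
    {H : Subgroup (Field.absoluteGaloisGroup F)}
    [hnorm : ((((unitGroup k).comap Φ.toMonoidHom).comap (galoisRepTorsion W p)).subgroupOf H).Normal]
    (hN : IsOpen (((((unitGroup k).comap Φ.toMonoidHom).comap (galoisRepTorsion W p)).subgroupOf H :
      Subgroup H) : Set H))
    (hM : ∀ m : geomTorsion W p, Continuous fun g : H ↦ g • m) {c : H}
    (hc : ∀ b : H, Xor (b * c⁻¹ ∈ (((unitGroup k).comap Φ.toMonoidHom).comap (galoisRepTorsion W p)).subgroupOf H)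
      (b ∈ (((unitGroup k).comap Φ.toMonoidHom).comap (galoisRepTorsion W p)).subgroupOf H)) :
    ∃ (u : geomTorsion W p →+ geomTorsion W p)
      (hu : ∀ (x : (((unitGroup k).comap Φ.toMonoidHom).comap (galoisRepTorsion W p)).subgroupOf H) (m : geomTorsion W p),
        u (x • m) = x • u m),
      Function.Injective fun ξ : subgroupH1 ((((unitGroup k).comap Φ.toMonoidHom).comap (galoisRepTorsion W p)).subgroupOf H) (geomTorsion W p) ↦
        (corH1 hN hM hc ξ, corH1 hN hM hc (resH1Hom (ContinuousMonoidHom.id _) u hu ξ)) := by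
  obtain ⟨u, v, hvu, hu, hv, hcu⟩ := exists_kStructure_endomorphism W hp Φ k e₀ he₀ hk h2 hGN
  have hcU : Φ (galoisRepTorsion W p ((c : H) : Field.absoluteGaloisGroup F)) ∉ unitGroup k := by
    intro h
    apply not_mem_of_xor hc
    rw [Subgroup.mem_subgroupOf, Subgroup.mem_comap, Subgroup.mem_comap]
    exact h
  refine ⟨u, fun x m ↦ hu _ (mem_unitGroup_of_mem_subgroupOf W Φ k x) m, ?_⟩
  exact injective_corH1_prod_corH1_pushH1 hN hM hc (Fact.out : p.Prime) hp
    (fun a ↦ Subtype.ext (by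
      rw [AddSubgroupClass.coe_nsmul, ZeroMemClass.coe_zero, ← natCast_zsmul]
      exact (mem_torsionPoints_iff _ _ (a : geomPoints W)).mp a.2))
    u v (fun x m ↦ hu _ (mem_unitGroup_of_mem_subgroupOf W Φ k x) m) (fun x m ↦ hv _ (mem_unitGroup_of_mem_subgroupOf W Φ k x) m)
    (fun m ↦ hcu _ hcU m) hvu

end Summit.BirchSwinnertonDyer.BirchSwinnertonDyer.Theorems.SmallImageCharSignedSelmer

end
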